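import Summits.CriticalPhenomena.PercolationContinuityZ3.Theorems.PercNearOneGluingNoHeavyLowerTailWorstPairExchangeCex

/-!
# `NoHeavyLowerTail` (stmt-CriticalPhenomena-4575) — the Kozma–Nitzan RESIDUAL ROW for EG₃ is FALSE:
# a certified weighted counterexample on five vertices (new-inequality factory, kernel no-go)

Factory PROOF seat `prim-ineq-prove-4`, 2026-08-19; memo `run/shared/lean/prim/prim-ineq-prove-4/KNS3-CEX.md`.

On 2026-08-19 three factory seats (prim-ineq-gen-6 "RES_A = (KNS)₃ / Φ_RES", prim-ineq-gen-7 "SD1", prim-ineq-prove-4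
"KN-EG") independently proposed the same candidate row closing three-relay event gluing EG₃ with the sharp constant:
with Kozma–Nitzan's six BHK steps (arXiv:2401.12397 Thm. 2; tree `knThm2_bhkOne/Two`) one has
`P₁P₂P₁₂·X ≥ Σ_O (∏_{O'≠O} P_{O'})·A_O (m_O − m_{A∖O})`, `X = μ(o↔A, o↔b) − μ(o↔A, a₃↔b)`, and the EG₃ slack is `X + Z`,
`Z = μ(o↮A, a₃↮b)`; the conjectured row was
  `(KNS)₃:  P₁P₂·A₁₂(m₁₂ − m₃) + P₂P₁₂·A₁(m₁ − m₂₃) + P₁P₁₂·A₂(m₂ − m₁₃) + P₁P₂P₁₂·Z ≥ 0`  whenever `a₃` is a worst relay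
(`μ(a₃↔b) ≤ μ(a₁↔b), μ(a₂↔b)`); it had 0 violations on all 94,659 worst-first instances of the wf3lp realizable dumps and in the
first adversarial searches, and `eg3_of_knResidual` (tree) shows it would give EG₃.

**It is false** (`not_knResidualRow`, witness `knResidualRow_cex_five`): `n = 5`, `o = 0`, `b = 4`, relays `a₃ = 1` (worst, tied
with `a₁ = 2`), `a₂ = 3`, weights `w(0,1) = w(0,2) = 199/200`, `w(0,3) = 1/6`, `w(1,4) = w(2,4) = 3/20`, `w(3,4) = 3/10`, all other
pairs `0`: the row evaluates to `−167269851589822145650681 / 1887436800000000000000000000000000 ≈ −8.9·10⁻¹¹ < 0` while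
`μ(a₃↔b) = μ(a₁↔b) = 99905369/320000000 ≤ μ(a₂↔b) = 106312379/320000000` and EG₃ itself HOLDS there
(`μ(o↔A ∖ o↔b) = 660063313/960000000 ≤ 660283893/960000000 = μ(a₃↮b)`, slack `≈ 2.3·10⁻⁴`).  Mechanism: two relays almost
glued to the observer (the designated worst one among them), the third relay hanging off `o` weakly but best tied to `b`, at
an exact tie of the two glued relays — KN's Lemma-2 defect `φ(12) − φ(1) − φ(2)` times the trace excess `m₃ − m₁₂ > 0` exceeds the
whole unattached slack `Z` (so the stronger rows SD1 `ψΔ ≤ μ(o↮A, a₃↮b)`, RES_C `ψΔ ≤ μ(o↮A, A↮b)` and RES_G fail too, by factors ≈ 2).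
The REFINED residual of `eg3_of_refinedResidual` is positive on this witness (≈ 0.995 of the EG₃ slack): that route survives.
Found by an adversarial climb of the seat (lab/climb_resg.py, focus.py), then coarsened; two independent exact evaluations
(partition DP and brute force over the `2⁶` configurations) agree with the kernel arithmetic below.

Contents: the events of the row as `Bool` tests on reach tables (`Fin 5`, 6 listed pairs), exact rational counts by KERNEL
reduction (`decide +kernel`, standard axioms, no `native_decide`), the measure side via `WorstPairExchangeCex.real_eq_wcount`,
and the deliverables `knResidualRow_cex_five` / `not_knResidualRow`.  No sorries; the `def`s are computable checkers and witness data only.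
-/

namespace Summit.CriticalPhenomena.PercolationContinuityZ3.Theorems

open MeasureTheory
open Literature.Probability.LatticeModels Literature.Probability.Percolation
open Summit.CriticalPhenomena.PercolationContinuityZ3.Theorems.AdditiveGluing.Negative.Cert
open Summit.CriticalPhenomena.PercolationContinuityZ3.Theorems.WorstPairExchangeCex (real_eq_wcount)

namespace KNResidualCex

/-! ### Events of the row as `Bool` tests on reach tables of `Fin 5` (labels `o = 0, b = 4, a₁ = 2, a₂ = 3, a₃ = 1`) -/

/-- `x ↔ y` on a reach table. -/
def cb (t : List ℕ) (x y : Fin 5) : Bool := (t.getD x.val 0).testBit y.val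

/-- `N₁₂ = {a₁↮a₃} ∩ {a₂↮a₃}`. -/
def fP12 (t : List ℕ) : Bool := !cb t 2 1 && !cb t 3 1
/-- `N₁ = {a₁↮a₂} ∩ {a₁↮a₃}`. -/
def fP1 (t : List ℕ) : Bool := !cb t 2 3 && !cb t 2 1
/-- `N₂ = {a₂↮a₁} ∩ {a₂↮a₃}`. -/
def fP2 (t : List ℕ) : Bool := !cb t 3 2 && !cb t 3 1
/-- `N₁₂ ∩ ({a₁↔o} ∪ {a₂↔o})`. -/
def fA12 (t : List ℕ) : Bool := fP12 t && (cb t 2 0 || cb t 3 0)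
/-- `N₁₂ ∩ {a₁↔b} ∩ {a₂↔b}`. -/
def fm12 (t : List ℕ) : Bool := fP12 t && (cb t 2 4 && cb t 3 4)
/-- `N₁₂ ∩ {a₃↔b}`. -/
def fm3 (t : List ℕ) : Bool := fP12 t && cb t 1 4
/-- `N₁ ∩ {a₁↔o}`. -/
def fA1 (t : List ℕ) : Bool := fP1 t && cb t 2 0
/-- `N₁ ∩ {a₁↔b}`. -/
def fm1 (t : List ℕ) : Bool := fP1 t && cb t 2 4
/-- `N₁ ∩ {a₂↔b} ∩ {a₃↔b}`. -/
def fm23 (t : List ℕ) : Bool := fP1 t && (cb t 3 4 && cb t 1 4)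
/-- `N₂ ∩ {a₂↔o}`. -/
def fA2 (t : List ℕ) : Bool := fP2 t && cb t 3 0
/-- `N₂ ∩ {a₂↔b}`. -/
def fm2 (t : List ℕ) : Bool := fP2 t && cb t 3 4
/-- `N₂ ∩ {a₁↔b} ∩ {a₃↔b}`. -/
def fm13 (t : List ℕ) : Bool := fP2 t && (cb t 2 4 && cb t 1 4)
/-- `Z`-event `{o↮A} ∩ {a₃↮b}`. -/
def fZ (t : List ℕ) : Bool := !(cb t 0 2 || cb t 0 3 || cb t 0 1) && !cb t 1 4
/-- `{o↔A} ∖ {o↔b}` (EG₃ event). -/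
def fE (t : List ℕ) : Bool := (cb t 0 2 || cb t 0 3 || cb t 0 1) && !cb t 0 4

/-- Exact weighted count of a `Bool` test for a weighted edge list on `Fin 5`. -/
def cnt (l : List (Fin 5 × Fin 5 × ℚ)) (f : List ℕ → Bool) : ℚ :=
  ((wtabs 5 l).map fun t => if f t.1 then t.2 else 0).sum

/-- The residual row (denominators cleared) as an exact rational. -/
def resid (l : List (Fin 5 × Fin 5 × ℚ)) : ℚ :=
  cnt l fP1 * cnt l fP2 * (cnt l fA12 * (cnt l fm12 - cnt l fm3))
  + cnt l fP2 * cnt l fP12 * (cnt l fA1 * (cnt l fm1 - cnt l fm23))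
  + cnt l fP1 * cnt l fP12 * (cnt l fA2 * (cnt l fm2 - cnt l fm13))
  + cnt l fP1 * cnt l fP2 * cnt l fP12 * cnt l fZ

/-! ### The witness -/

/-- The witness: pairs `0–1 199/200 · 0–2 199/200 · 0–3 1/6 · 1–4 3/20 · 2–4 3/20 · 3–4 3/10`. -/
def cK : List (Fin 5 × Fin 5 × ℚ) :=
  [(0, 1, 199/200), (0, 2, 199/200), (0, 3, 1/6), (1, 4, 3/20), (2, 4, 3/20), (3, 4, 3/10)]

/-- The listed pairs are distinct. [this file] -/
theorem cK_nodup : (wPairs cK).Nodup := by decide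

/-- The weights lie in `[0, 1]`. [this file] -/
theorem cK_weights : ∀ e ∈ cK, 0 ≤ e.2.2 ∧ e.2.2 ≤ 1 := by
  intro e he
  simp only [cK, List.mem_cons, List.not_mem_nil, or_false] at he
  rcases he with rfl | rfl | rfl | rfl | rfl | rfl
  all_goals norm_num

/-! ### The arithmetic (kernel reduction over the `2⁶` configurations) -/

/-- The residual row is NEGATIVE on the witness. [this file] -/
theorem resid_cK_neg : resid cK < 0 := by decide +kernel

/-- Its exact value: `−167269851589822145650681 / 1887436800000000000000000000000000`. [this file] -/
theorem resid_cK_value : resid cK = -167269851589822145650681 / 1887436800000000000000000000000000 := by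
  decide +kernel

/-- `a₃ = 1` is a worst relay: `μ(a₃↔b) ≤ μ(a₁↔b)` and `μ(a₃↔b) ≤ μ(a₂↔b)` (exact values `99905369/320000000` twice and
`106312379/320000000`), and the three conditioning masses are positive. [this file] -/
theorem facts_cK : cnt cK (fun t => cb t 1 4) ≤ cnt cK (fun t => cb t 2 4) ∧ cnt cK (fun t => cb t 1 4) ≤ cnt cK (fun t => cb t 3 4) ∧
    0 < cnt cK fP12 ∧ 0 < cnt cK fP1 ∧ 0 < cnt cK fP2 := by
  decide +kernel

/-- EG₃ itself holds on the witness: `μ({o↔A} ∖ {o↔b}) = 660063313/960000000 ≤ 660283893/960000000 = μ(a₃↮b)`. [this file] -/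
theorem eg3_cK : cnt cK fE ≤ cnt cK (fun t => !cb t 1 4) := by decide +kernel

/-! ### Measure side -/

open scoped Classical

variable {l : List (Fin 5 × Fin 5 × ℚ)}

/-- `cb` reads `openConn`. [this file] -/
theorem cb_iff (ω : List (Fin 5 × Fin 5)) (x y : Fin 5) :
    cb (reachTable 5 ω) x y = true ↔ (↑(Eset ω) : Set (Sym2 (Fin 5))) ∈ openConn x y :=
  testBit_reachTable_iff_mem_openConn ω x y

/-- `μ(N₁₂) = cnt fP12`. [this file] -/
theorem real_P12 (hnd : (wPairs l).Nodup) (hq : ∀ e ∈ l, 0 ≤ e.2.2 ∧ e.2.2 ≤ 1) :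
    (prodBernoulli (wOfList l)).real ((openConn (2 : Fin 5) 1)ᶜ ∩ (openConn (3 : Fin 5) 1)ᶜ : Set (BondConfig (Fin 5))) =
      (cnt l fP12 : ℝ) := by
  refine real_eq_wcount hnd hq fP12 _ fun ω => ?_
  simp only [fP12, Bool.and_eq_true, Bool.not_eq_true', ← Bool.not_eq_true, cb_iff, Set.mem_inter_iff, Set.mem_compl_iff]

/-- `μ(N₁) = cnt fP1`. [this file] -/
theorem real_P1 (hnd : (wPairs l).Nodup) (hq : ∀ e ∈ l, 0 ≤ e.2.2 ∧ e.2.2 ≤ 1) :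
    (prodBernoulli (wOfList l)).real ((openConn (2 : Fin 5) 3)ᶜ ∩ (openConn (2 : Fin 5) 1)ᶜ : Set (BondConfig (Fin 5))) =
      (cnt l fP1 : ℝ) := by
  refine real_eq_wcount hnd hq fP1 _ fun ω => ?_
  simp only [fP1, Bool.and_eq_true, Bool.not_eq_true', ← Bool.not_eq_true, cb_iff, Set.mem_inter_iff, Set.mem_compl_iff]

/-- `μ(N₂) = cnt fP2`. [this file] -/
theorem real_P2 (hnd : (wPairs l).Nodup) (hq : ∀ e ∈ l, 0 ≤ e.2.2 ∧ e.2.2 ≤ 1) :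
    (prodBernoulli (wOfList l)).real ((openConn (3 : Fin 5) 2)ᶜ ∩ (openConn (3 : Fin 5) 1)ᶜ : Set (BondConfig (Fin 5))) =
      (cnt l fP2 : ℝ) := by
  refine real_eq_wcount hnd hq fP2 _ fun ω => ?_
  simp only [fP2, Bool.and_eq_true, Bool.not_eq_true', ← Bool.not_eq_true, cb_iff, Set.mem_inter_iff, Set.mem_compl_iff]

/-- `μ(N₁₂ ∩ (a₁o ∪ a₂o)) = cnt fA12`. [this file] -/
theorem real_A12 (hnd : (wPairs l).Nodup) (hq : ∀ e ∈ l, 0 ≤ e.2.2 ∧ e.2.2 ≤ 1) :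
    (prodBernoulli (wOfList l)).real ((openConn (2 : Fin 5) 1)ᶜ ∩ (openConn (3 : Fin 5) 1)ᶜ ∩ (openConn 2 0 ∪ openConn 3 0)) =
      (cnt l fA12 : ℝ) := by
  refine real_eq_wcount hnd hq fA12 _ fun ω => ?_
  simp only [fA12, fP12, Bool.and_eq_true, Bool.or_eq_true, Bool.not_eq_true', ← Bool.not_eq_true, cb_iff,
    Set.mem_inter_iff, Set.mem_compl_iff, Set.mem_union]

/-- `μ(N₁₂ ∩ a₁b ∩ a₂b) = cnt fm12`. [this file] -/
theorem real_m12 (hnd : (wPairs l).Nodup) (hq : ∀ e ∈ l, 0 ≤ e.2.2 ∧ e.2.2 ≤ 1) :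
    (prodBernoulli (wOfList l)).real ((openConn (2 : Fin 5) 1)ᶜ ∩ (openConn (3 : Fin 5) 1)ᶜ ∩ (openConn 2 4 ∩ openConn 3 4)) =
      (cnt l fm12 : ℝ) := by
  refine real_eq_wcount hnd hq fm12 _ fun ω => ?_
  simp only [fm12, fP12, Bool.and_eq_true, Bool.not_eq_true', ← Bool.not_eq_true, cb_iff,
    Set.mem_inter_iff, Set.mem_compl_iff]

/-- `μ(N₁₂ ∩ a₃b) = cnt fm3`. [this file] -/
theorem real_m3 (hnd : (wPairs l).Nodup) (hq : ∀ e ∈ l, 0 ≤ e.2.2 ∧ e.2.2 ≤ 1) :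
    (prodBernoulli (wOfList l)).real ((openConn (2 : Fin 5) 1)ᶜ ∩ (openConn (3 : Fin 5) 1)ᶜ ∩ openConn 1 4) =
      (cnt l fm3 : ℝ) := by
  refine real_eq_wcount hnd hq fm3 _ fun ω => ?_
  simp only [fm3, fP12, Bool.and_eq_true, Bool.not_eq_true', ← Bool.not_eq_true, cb_iff,
    Set.mem_inter_iff, Set.mem_compl_iff]

/-- `μ(N₁ ∩ a₁o) = cnt fA1`. [this file] -/
theorem real_A1 (hnd : (wPairs l).Nodup) (hq : ∀ e ∈ l, 0 ≤ e.2.2 ∧ e.2.2 ≤ 1) :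
    (prodBernoulli (wOfList l)).real ((openConn (2 : Fin 5) 3)ᶜ ∩ (openConn (2 : Fin 5) 1)ᶜ ∩ openConn 2 0) =
      (cnt l fA1 : ℝ) := by
  refine real_eq_wcount hnd hq fA1 _ fun ω => ?_
  simp only [fA1, fP1, Bool.and_eq_true, Bool.not_eq_true', ← Bool.not_eq_true, cb_iff,
    Set.mem_inter_iff, Set.mem_compl_iff]

/-- `μ(N₁ ∩ a₁b) = cnt fm1`. [this file] -/
theorem real_m1 (hnd : (wPairs l).Nodup) (hq : ∀ e ∈ l, 0 ≤ e.2.2 ∧ e.2.2 ≤ 1) :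
    (prodBernoulli (wOfList l)).real ((openConn (2 : Fin 5) 3)ᶜ ∩ (openConn (2 : Fin 5) 1)ᶜ ∩ openConn 2 4) =
      (cnt l fm1 : ℝ) := by
  refine real_eq_wcount hnd hq fm1 _ fun ω => ?_
  simp only [fm1, fP1, Bool.and_eq_true, Bool.not_eq_true', ← Bool.not_eq_true, cb_iff,
    Set.mem_inter_iff, Set.mem_compl_iff]

/-- `μ(N₁ ∩ a₂b ∩ a₃b) = cnt fm23`. [this file] -/
theorem real_m23 (hnd : (wPairs l).Nodup) (hq : ∀ e ∈ l, 0 ≤ e.2.2 ∧ e.2.2 ≤ 1) :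
    (prodBernoulli (wOfList l)).real ((openConn (2 : Fin 5) 3)ᶜ ∩ (openConn (2 : Fin 5) 1)ᶜ ∩ (openConn 3 4 ∩ openConn 1 4)) =
      (cnt l fm23 : ℝ) := by
  refine real_eq_wcount hnd hq fm23 _ fun ω => ?_
  simp only [fm23, fP1, Bool.and_eq_true, Bool.not_eq_true', ← Bool.not_eq_true, cb_iff,
    Set.mem_inter_iff, Set.mem_compl_iff]

/-- `μ(N₂ ∩ a₂o) = cnt fA2`. [this file] -/
theorem real_A2 (hnd : (wPairs l).Nodup) (hq : ∀ e ∈ l, 0 ≤ e.2.2 ∧ e.2.2 ≤ 1) :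
    (prodBernoulli (wOfList l)).real ((openConn (3 : Fin 5) 2)ᶜ ∩ (openConn (3 : Fin 5) 1)ᶜ ∩ openConn 3 0) =
      (cnt l fA2 : ℝ) := by
  refine real_eq_wcount hnd hq fA2 _ fun ω => ?_
  simp only [fA2, fP2, Bool.and_eq_true, Bool.not_eq_true', ← Bool.not_eq_true, cb_iff,
    Set.mem_inter_iff, Set.mem_compl_iff]

/-- `μ(N₂ ∩ a₂b) = cnt fm2`. [this file] -/
theorem real_m2 (hnd : (wPairs l).Nodup) (hq : ∀ e ∈ l, 0 ≤ e.2.2 ∧ e.2.2 ≤ 1) :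
    (prodBernoulli (wOfList l)).real ((openConn (3 : Fin 5) 2)ᶜ ∩ (openConn (3 : Fin 5) 1)ᶜ ∩ openConn 3 4) =
      (cnt l fm2 : ℝ) := by
  refine real_eq_wcount hnd hq fm2 _ fun ω => ?_
  simp only [fm2, fP2, Bool.and_eq_true, Bool.not_eq_true', ← Bool.not_eq_true, cb_iff,
    Set.mem_inter_iff, Set.mem_compl_iff]

/-- `μ(N₂ ∩ a₁b ∩ a₃b) = cnt fm13`. [this file] -/
theorem real_m13 (hnd : (wPairs l).Nodup) (hq : ∀ e ∈ l, 0 ≤ e.2.2 ∧ e.2.2 ≤ 1) :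
    (prodBernoulli (wOfList l)).real ((openConn (3 : Fin 5) 2)ᶜ ∩ (openConn (3 : Fin 5) 1)ᶜ ∩ (openConn 2 4 ∩ openConn 1 4)) =
      (cnt l fm13 : ℝ) := by
  refine real_eq_wcount hnd hq fm13 _ fun ω => ?_
  simp only [fm13, fP2, Bool.and_eq_true, Bool.not_eq_true', ← Bool.not_eq_true, cb_iff,
    Set.mem_inter_iff, Set.mem_compl_iff]

/-- `μ({o↮A} ∩ {a₃↮b}) = cnt fZ`. [this file] -/
theorem real_Z (hnd : (wPairs l).Nodup) (hq : ∀ e ∈ l, 0 ≤ e.2.2 ∧ e.2.2 ≤ 1) :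
    (prodBernoulli (wOfList l)).real ((openConn (0 : Fin 5) 2 ∪ openConn 0 3 ∪ openConn 0 1)ᶜ ∩ (openConn 1 4)ᶜ) =
      (cnt l fZ : ℝ) := by
  refine real_eq_wcount hnd hq fZ _ fun ω => ?_
  simp only [fZ, Bool.and_eq_true, Bool.or_eq_true, Bool.not_eq_true', ← Bool.not_eq_true, cb_iff,
    Set.mem_inter_iff, Set.mem_compl_iff, Set.mem_union]

/-- `μ(a₃↔b) = cnt (cb·1 4)` etc.: a single connection. [this file] -/
theorem real_conn (hnd : (wPairs l).Nodup) (hq : ∀ e ∈ l, 0 ≤ e.2.2 ∧ e.2.2 ≤ 1) (x y : Fin 5) :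
    (prodBernoulli (wOfList l)).real (openConn x y) = (cnt l (fun t => cb t x y) : ℝ) := by
  refine real_eq_wcount hnd hq (fun t => cb t x y) _ fun ω => ?_
  simp only [cb_iff]

end KNResidualCex

open KNResidualCex
open scoped Classical

/-- **The counterexample as an instance.**  For the weight `wOfList cK` on `Fin 5` with `o = 0`, `b = 4`, `a₁ = 2`, `a₂ = 3`,
`a₃ = 1`: `a₃` is a worst relay, the three KN conditioning masses are positive, and the residual row of `eg3_of_knResidual`
is NEGATIVE. [this file] -/
theorem knResidualRow_cex_five :
    (prodBernoulli (wOfList cK)).real (openConn (1 : Fin 5) 4) ≤ (prodBernoulli (wOfList cK)).real (openConn (2 : Fin 5) 4) ∧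
    (prodBernoulli (wOfList cK)).real (openConn (1 : Fin 5) 4) ≤ (prodBernoulli (wOfList cK)).real (openConn (3 : Fin 5) 4) ∧
    0 < (prodBernoulli (wOfList cK)).real ((openConn (2 : Fin 5) 1)ᶜ ∩ (openConn (3 : Fin 5) 1)ᶜ : Set (BondConfig (Fin 5))) ∧
    0 < (prodBernoulli (wOfList cK)).real ((openConn (2 : Fin 5) 3)ᶜ ∩ (openConn (2 : Fin 5) 1)ᶜ : Set (BondConfig (Fin 5))) ∧
    0 < (prodBernoulli (wOfList cK)).real ((openConn (3 : Fin 5) 2)ᶜ ∩ (openConn (3 : Fin 5) 1)ᶜ : Set (BondConfig (Fin 5))) ∧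
    (prodBernoulli (wOfList cK)).real ((openConn (2 : Fin 5) 3)ᶜ ∩ (openConn (2 : Fin 5) 1)ᶜ : Set (BondConfig (Fin 5)))
          * (prodBernoulli (wOfList cK)).real ((openConn (3 : Fin 5) 2)ᶜ ∩ (openConn (3 : Fin 5) 1)ᶜ : Set (BondConfig (Fin 5)))
          * ((prodBernoulli (wOfList cK)).real ((openConn (2 : Fin 5) 1)ᶜ ∩ (openConn (3 : Fin 5) 1)ᶜ ∩ (openConn 2 0 ∪ openConn 3 0))
            * ((prodBernoulli (wOfList cK)).real ((openConn (2 : Fin 5) 1)ᶜ ∩ (openConn (3 : Fin 5) 1)ᶜ ∩ (openConn 2 4 ∩ openConn 3 4))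
              - (prodBernoulli (wOfList cK)).real ((openConn (2 : Fin 5) 1)ᶜ ∩ (openConn (3 : Fin 5) 1)ᶜ ∩ openConn 1 4)))
      + (prodBernoulli (wOfList cK)).real ((openConn (3 : Fin 5) 2)ᶜ ∩ (openConn (3 : Fin 5) 1)ᶜ : Set (BondConfig (Fin 5)))
          * (prodBernoulli (wOfList cK)).real ((openConn (2 : Fin 5) 1)ᶜ ∩ (openConn (3 : Fin 5) 1)ᶜ : Set (BondConfig (Fin 5)))
          * ((prodBernoulli (wOfList cK)).real ((openConn (2 : Fin 5) 3)ᶜ ∩ (openConn (2 : Fin 5) 1)ᶜ ∩ openConn 2 0)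
            * ((prodBernoulli (wOfList cK)).real ((openConn (2 : Fin 5) 3)ᶜ ∩ (openConn (2 : Fin 5) 1)ᶜ ∩ openConn 2 4)
              - (prodBernoulli (wOfList cK)).real ((openConn (2 : Fin 5) 3)ᶜ ∩ (openConn (2 : Fin 5) 1)ᶜ ∩ (openConn 3 4 ∩ openConn 1 4))))
      + (prodBernoulli (wOfList cK)).real ((openConn (2 : Fin 5) 3)ᶜ ∩ (openConn (2 : Fin 5) 1)ᶜ : Set (BondConfig (Fin 5)))
          * (prodBernoulli (wOfList cK)).real ((openConn (2 : Fin 5) 1)ᶜ ∩ (openConn (3 : Fin 5) 1)ᶜ : Set (BondConfig (Fin 5)))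
          * ((prodBernoulli (wOfList cK)).real ((openConn (3 : Fin 5) 2)ᶜ ∩ (openConn (3 : Fin 5) 1)ᶜ ∩ openConn 3 0)
            * ((prodBernoulli (wOfList cK)).real ((openConn (3 : Fin 5) 2)ᶜ ∩ (openConn (3 : Fin 5) 1)ᶜ ∩ openConn 3 4)
              - (prodBernoulli (wOfList cK)).real ((openConn (3 : Fin 5) 2)ᶜ ∩ (openConn (3 : Fin 5) 1)ᶜ ∩ (openConn 2 4 ∩ openConn 1 4))))
      + (prodBernoulli (wOfList cK)).real ((openConn (2 : Fin 5) 3)ᶜ ∩ (openConn (2 : Fin 5) 1)ᶜ : Set (BondConfig (Fin 5)))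
          * (prodBernoulli (wOfList cK)).real ((openConn (3 : Fin 5) 2)ᶜ ∩ (openConn (3 : Fin 5) 1)ᶜ : Set (BondConfig (Fin 5)))
          * (prodBernoulli (wOfList cK)).real ((openConn (2 : Fin 5) 1)ᶜ ∩ (openConn (3 : Fin 5) 1)ᶜ : Set (BondConfig (Fin 5)))
          * (prodBernoulli (wOfList cK)).real ((openConn (0 : Fin 5) 2 ∪ openConn 0 3 ∪ openConn 0 1)ᶜ ∩ (openConn 1 4)ᶜ) < 0 := by
  have hnd := cK_nodup
  have hq := cK_weights
  obtain ⟨hw1, hw2, hp12, hp1, hp2⟩ := facts_cK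
  have hneg := resid_cK_neg
  rw [real_conn hnd hq, real_conn hnd hq, real_conn hnd hq, real_P12 hnd hq, real_P1 hnd hq, real_P2 hnd hq,
    real_A12 hnd hq, real_m12 hnd hq, real_m3 hnd hq, real_A1 hnd hq, real_m1 hnd hq, real_m23 hnd hq,
    real_A2 hnd hq, real_m2 hnd hq, real_m13 hnd hq, real_Z hnd hq]
  refine ⟨by exact_mod_cast hw1, by exact_mod_cast hw2, by exact_mod_cast hp12, by exact_mod_cast hp1, by exact_mod_cast hp2, ?_⟩
  unfold resid at hneg
  exact_mod_cast hneg

/-- **The Kozma–Nitzan residual row `(KNS)₃` is false.**  It is NOT true that for every finite weighted graph and all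
distinct `o, a₁, a₂, a₃` with `a₃` a worst relay (`μ(a₃↔b) ≤ μ(a₁↔b)`, `μ(a₃↔b) ≤ μ(a₂↔b)`) and positive conditioning masses the
residual row `P₁P₂·A₁₂(m₁₂ − m₃) + P₂P₁₂·A₁(m₁ − m₂₃) + P₁P₁₂·A₂(m₂ − m₁₃) + P₁P₂P₁₂·μ(o↮A, a₃↮b)` (the hypothesis `hres` of
`eg3_of_knResidual`) is nonnegative: witness `knResidualRow_cex_five`. [this file] -/
theorem not_knResidualRow :
    ¬ (∀ (n : ℕ) (w : Sym2 (Fin n) → unitInterval) (o b a₁ a₂ a₃ : Fin n),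
        a₁ ≠ a₂ → a₁ ≠ a₃ → a₂ ≠ a₃ → o ≠ a₁ → o ≠ a₂ → o ≠ a₃ →
        (prodBernoulli w).real (openConn a₃ b) ≤ (prodBernoulli w).real (openConn a₁ b) →
        (prodBernoulli w).real (openConn a₃ b) ≤ (prodBernoulli w).real (openConn a₂ b) →
        0 < (prodBernoulli w).real ((openConn a₁ a₃)ᶜ ∩ (openConn a₂ a₃)ᶜ : Set (BondConfig (Fin n))) →
        0 < (prodBernoulli w).real ((openConn a₁ a₂)ᶜ ∩ (openConn a₁ a₃)ᶜ : Set (BondConfig (Fin n))) →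
        0 < (prodBernoulli w).real ((openConn a₂ a₁)ᶜ ∩ (openConn a₂ a₃)ᶜ : Set (BondConfig (Fin n))) →
        0 ≤
          (prodBernoulli w).real ((openConn a₁ a₂)ᶜ ∩ (openConn a₁ a₃)ᶜ : Set (BondConfig (Fin n)))
            * (prodBernoulli w).real ((openConn a₂ a₁)ᶜ ∩ (openConn a₂ a₃)ᶜ : Set (BondConfig (Fin n)))
            * ((prodBernoulli w).real ((openConn a₁ a₃)ᶜ ∩ (openConn a₂ a₃)ᶜ ∩ (openConn a₁ o ∪ openConn a₂ o))
              * ((prodBernoulli w).real ((openConn a₁ a₃)ᶜ ∩ (openConn a₂ a₃)ᶜ ∩ (openConn a₁ b ∩ openConn a₂ b))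
                - (prodBernoulli w).real ((openConn a₁ a₃)ᶜ ∩ (openConn a₂ a₃)ᶜ ∩ openConn a₃ b)))
        + (prodBernoulli w).real ((openConn a₂ a₁)ᶜ ∩ (openConn a₂ a₃)ᶜ : Set (BondConfig (Fin n)))
            * (prodBernoulli w).real ((openConn a₁ a₃)ᶜ ∩ (openConn a₂ a₃)ᶜ : Set (BondConfig (Fin n)))
            * ((prodBernoulli w).real ((openConn a₁ a₂)ᶜ ∩ (openConn a₁ a₃)ᶜ ∩ openConn a₁ o)
              * ((prodBernoulli w).real ((openConn a₁ a₂)ᶜ ∩ (openConn a₁ a₃)ᶜ ∩ openConn a₁ b)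
                - (prodBernoulli w).real ((openConn a₁ a₂)ᶜ ∩ (openConn a₁ a₃)ᶜ ∩ (openConn a₂ b ∩ openConn a₃ b))))
        + (prodBernoulli w).real ((openConn a₁ a₂)ᶜ ∩ (openConn a₁ a₃)ᶜ : Set (BondConfig (Fin n)))
            * (prodBernoulli w).real ((openConn a₁ a₃)ᶜ ∩ (openConn a₂ a₃)ᶜ : Set (BondConfig (Fin n)))
            * ((prodBernoulli w).real ((openConn a₂ a₁)ᶜ ∩ (openConn a₂ a₃)ᶜ ∩ openConn a₂ o)
              * ((prodBernoulli w).real ((openConn a₂ a₁)ᶜ ∩ (openConn a₂ a₃)ᶜ ∩ openConn a₂ b)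
                - (prodBernoulli w).real ((openConn a₂ a₁)ᶜ ∩ (openConn a₂ a₃)ᶜ ∩ (openConn a₁ b ∩ openConn a₃ b))))
        + (prodBernoulli w).real ((openConn a₁ a₂)ᶜ ∩ (openConn a₁ a₃)ᶜ : Set (BondConfig (Fin n)))
            * (prodBernoulli w).real ((openConn a₂ a₁)ᶜ ∩ (openConn a₂ a₃)ᶜ : Set (BondConfig (Fin n)))
            * (prodBernoulli w).real ((openConn a₁ a₃)ᶜ ∩ (openConn a₂ a₃)ᶜ : Set (BondConfig (Fin n)))
            * (prodBernoulli w).real ((openConn o a₁ ∪ openConn o a₂ ∪ openConn o a₃)ᶜ ∩ (openConn a₃ b)ᶜ)) := by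
  intro h
  obtain ⟨hw1, hw2, hp12, hp1, hp2, hneg⟩ := knResidualRow_cex_five
  have hc := h 5 (wOfList cK) 0 4 2 3 1 (by decide) (by decide) (by decide) (by decide) (by decide) (by decide)
    hw1 hw2 hp12 hp1 hp2
  exact absurd hc (not_le.2 hneg)

end Summit.CriticalPhenomena.PercolationContinuityZ3.Theorems
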